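import Summits.AtomisticToContinuum.HydrodynamicLimit.Theorems.CollisionIsometryCLTAdaptedWeightCLTBHDVTransferInputs
import Summits.AtomisticToContinuum.HydrodynamicLimit.Theorems.CollisionIsometryCLTAdaptedWeightCLTBHCoarsening

/-!
# Vocabulary B of the line `block-h-dissipation-closure` for the crux `AdaptedWeightCLT`
(stmt-AtomisticToContinuum-14868, rev-12 TIME-LOCAL form; route `CollisionIsometryCLT`, sub-problem
`HydrodynamicLimit`): the RESHAPED stub statements after wave 1

Definitions-only support file (`--supports stmt-AtomisticToContinuum-14868`, anchor `blockHB_vocab_anchor`) of the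
line lead `prover-line-stmt-AtomisticToContinuum-14868-c4-0`. Wave 1 of the line settled four of the planner's seven
stubs CONDITIONALLY and identified their honest inputs (all landed, namespace `…Theorems.BlockHDissipation`):
* S1 `stub_entropyBudget` is `budgetDecompOn_of_bregSmall` (…BHEntropyBudget.lean) GIVEN the Bregman-sum bound
  `BregSmallOn` below — the per-contact Bregman remainders are small only at NON-LONELY contact velocities, which
  `TailsOn` + `FewCollisionsOn` do not control (stub-misstated);
* S2 `stub_dvTransfer` is `dvTransferStub'_holds` (…BHDVTransferInputs.lean) GIVEN the four typed inputs of the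
  Donsker–Varadhan chain `IncrToMeasureOn` (G1), `DVAggregateOn` (G2, provable bookkeeping), `CrossHellingerOn` (G3),
  `ChaosTimeOn` (G4) (stub-misstated; G1/G3/G4 are per-contact commutator inputs of the same lonely-contact class);
* S5 `stub_eepClosure` is `bhEEPClosure_conditional` (…BHEEPClosure.lean) GIVEN the Literature fact
  `Literature.MathematicalPhysics.KineticTheory.HardSphereEEP` (Villani 2003 / Rezakhanlou–Villani LNM 1916 Thm 4);
* S6 `stub_coarsening` is `bhCoarsening_of_reynolds` (…BHCoarsening.lean) GIVEN the sub-block Reynolds remainder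
  `SubBlockReynoldsOn` (the declared hydro-class exposure shared by every line on this crux);
* S0 `stub_fewCollisions` in its `∃ σ₀` form is `fewCollisionsOn_of_collisionMomentBound`
  (…BHFewCollisionsReduction.lean) GIVEN the open support item `Theses.InformationPercolationEngine.CollisionMomentBound`
  (stmt-AtomisticToContinuum-15144).
This file types the statements of the RESHAPED registered stubs of skeleton v3 (seven again): `FewCollisionsSmallSigmaStub`
(S0 in `∃ σ₀` form), `BregSmallOn`/`BregSmallStub` (S1′), `DVCommutatorsStub` (S2′ = G1 ∧ G3 ∧ G4), `DVAggregateStub`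
(S2″ = G2), `ReynoldsBHStub` (S6′); `EntropyChaosRelStub` (S3) and `ContactToMassStub` (S4) are unchanged (vocabulary A).
Nothing is asserted: every `def … : Prop` is a predicate.
-/

namespace Summit.AtomisticToContinuum.HydrodynamicLimit.Theorems.BlockHDissipation

open scoped BigOperators Topology Classical MeasureTheory ENNReal InnerProductSpace
open Filter Set MeasureTheory
open Literature.Analysis.FluidPDE
open Summit.AtomisticToContinuum.HydrodynamicLimit.Theorems.ContactSourceDuhamel (T3 V3 Cfg Vel Flow Flows)
open Summit.AtomisticToContinuum.HydrodynamicLimit.Theorems.ContactSourceDuhamel.TimeLocal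
open Literature.MathematicalPhysics.KineticTheory (hsDiameter localGibbsLaw)

noncomputable section

/-- S0 in its `∃ σ₀` form (FEW COLLISIONS for small reduced density): for nice profiles there is `σ₀ > 0` such that
for `0 < σ < σ₀`, every flow family and every `t > 0`, `FewCollisionsOn σ a₀ θ₀ u₀ Φ t`. Equals the consequence of the
open support item `CollisionMomentBound` (stmt-15144) by `fewCollisionsOn_of_collisionMomentBound`; the composition only
ever needs small `σ`. -/
def FewCollisionsSmallSigmaStub : Prop :=
  ∀ (a₀ θ₀ : T3 → ℝ) (u₀ : T3 → V3), NiceProfiles a₀ θ₀ u₀ → ∃ σ₀ : ℝ, 0 < σ₀ ∧ ∀ σ : ℝ, 0 < σ → σ < σ₀ →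
    ∀ (Φ : Flows σ) (t : ℝ), 0 < t → FewCollisionsOn σ a₀ θ₀ u₀ Φ t

/-- BREGMAN SUM SMALL on `[0, t]`: for every `p > 0`, `P_N{(N+1)^{γc+p} < bregS} → 0` — the collision pair sum of the
(nonnegative) Bregman remainders of the regularised cell entropy is `o((N+1)^{γc+p})` in probability. Verbatim the
extra hypothesis of `budgetDecompOn_of_bregSmall`. -/
def BregSmallOn (σ : ℝ) (a₀ θ₀ : T3 → ℝ) (u₀ : T3 → V3) (Φ : Flows σ) (ψ : ℕ → T3 → ℝ) (γc h δ t : ℝ) :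
    Prop :=
  ∀ p : ℝ, 0 < p → Tendsto (fun N : ℕ => localGibbsLaw σ a₀ u₀ θ₀ N (Φ N)
    {z | ((N + 1 : ℕ) : ℝ) ^ (γc + p) < bregS σ N (Φ N) ψ h δ t z}) atTop (𝓝 0)

/-- S1′ (the residual input of the entropy budget): for nice profiles, `0 < σ < 1/2`, an admissible cell family at
exponent `γc ∈ (1/6, 1/3)`, `(h, δ) ∈ (0,1)²`, every flow family and `t > 0` with H2 and few collisions:
`BregSmallOn`. CONTENT: a lonely-contact census — Bregman remainders are `≲ (N+1)⁻¹(m_cell h³ δ)⁻¹`-small per contact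
at populous contact velocities and `≲ (log N + |v − ū|²/(θ̄ + h²))/(N+1)` at lonely ones. -/
def BregSmallStub : Prop :=
  ∀ (a₀ θ₀ : T3 → ℝ) (u₀ : T3 → V3), NiceProfiles a₀ θ₀ u₀ → ∀ σ : ℝ, 0 < σ → σ < 2⁻¹ →
    ∀ (γc C' : ℝ) (ψ : ℕ → T3 → ℝ), 1 / 6 < γc → γc < 1 / 3 → AdmissibleKernel γc C' ψ →
      ∀ h δ : ℝ, 0 < h → h < 1 → 0 < δ → δ < 1 → ∀ (Φ : Flows σ) (t : ℝ), 0 < t →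
        TailsOn σ a₀ θ₀ u₀ Φ t → FewCollisionsOn σ a₀ θ₀ u₀ Φ t → BregSmallOn σ a₀ θ₀ u₀ Φ ψ γc h δ t

/-- S2′ (the per-contact COMMUTATOR inputs of the Donsker–Varadhan chain, bundled): for nice profiles,
`0 < σ < 1/2`, an admissible cell family, every flow family and `t > 0` with H2 and few collisions, and every
`(h, δ) ∈ (0,1)²`: `IncrToMeasureOn` (G1) ∧ `CrossHellingerOn` (G3) ∧ `ChaosTimeOn` (G4). Same lonely-contact class
as `BregSmallStub`. -/
def DVCommutatorsStub : Prop :=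
  ∀ (a₀ θ₀ : T3 → ℝ) (u₀ : T3 → V3), NiceProfiles a₀ θ₀ u₀ → ∀ σ : ℝ, 0 < σ → σ < 2⁻¹ →
    ∀ (γc C' : ℝ) (ψ : ℕ → T3 → ℝ), 1 / 6 < γc → γc < 1 / 3 → AdmissibleKernel γc C' ψ →
      ∀ (Φ : Flows σ) (t : ℝ), 0 < t → TailsOn σ a₀ θ₀ u₀ Φ t → FewCollisionsOn σ a₀ θ₀ u₀ Φ t →
        ∀ h δ : ℝ, 0 < h → h < 1 → 0 < δ → δ < 1 →
          IncrToMeasureOn σ a₀ θ₀ u₀ Φ ψ γc h δ t ∧ CrossHellingerOn σ a₀ θ₀ u₀ Φ ψ γc h δ t ∧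
            ChaosTimeOn σ a₀ θ₀ u₀ Φ ψ γc h δ t

/-- S2″ (the AGGREGATE Donsker–Varadhan step, provable bookkeeping): same prefix, then `DVAggregateOn` (G2:
`dvActW ≥ crossEW − relEnt` up to `η (N+1)^{1/3}`; `dv_step` of …BHDVTransferStep integrated in `x` and summed in `k` —
needs only `x`-measurability/integrability of the three parametric integrals on good orbits). -/
def DVAggregateStub : Prop :=
  ∀ (a₀ θ₀ : T3 → ℝ) (u₀ : T3 → V3), NiceProfiles a₀ θ₀ u₀ → ∀ σ : ℝ, 0 < σ → σ < 2⁻¹ →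
    ∀ (γc C' : ℝ) (ψ : ℕ → T3 → ℝ), 1 / 6 < γc → γc < 1 / 3 → AdmissibleKernel γc C' ψ →
      ∀ (Φ : Flows σ) (t : ℝ), 0 < t → TailsOn σ a₀ θ₀ u₀ Φ t → FewCollisionsOn σ a₀ θ₀ u₀ Φ t →
        ∀ h δ : ℝ, 0 < h → h < 1 → 0 < δ → δ < 1 → DVAggregateOn σ a₀ θ₀ u₀ Φ ψ γc h δ t

/-- S6′ (the SUB-BLOCK REYNOLDS REMAINDER, declared hydro-class exposure of the line): for nice profiles there is
`σ₀ > 0` such that for `0 < σ < σ₀`, `γc ∈ (1/6, 1/3)`, every flow family with diffuse backward influence (H1),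
every admissible block family (`γ ≤ 1/15`) and every `t > 0` with H2 on `[0, t]`: `SubBlockReynoldsOn σ a₀ θ₀ u₀ Φ γc φ t`
(the Germano-density Reynolds functional `ReynG` vanishes in `L¹([0,t] × 𝕋³)`-probability for every admissible cell
family). Pre-shock this is MesoQuiescence-class; post-shock it is the crux's own `∀ t > 0` exposure. -/
def ReynoldsBHStub : Prop :=
  ∀ (a₀ θ₀ : T3 → ℝ) (u₀ : T3 → V3), NiceProfiles a₀ θ₀ u₀ → ∃ σ₀ : ℝ, 0 < σ₀ ∧ ∀ σ : ℝ, 0 < σ → σ < σ₀ →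
    ∀ γc : ℝ, 1 / 6 < γc → γc < 1 / 3 → ∀ Φ : Flows σ, DiffuseAt σ a₀ θ₀ u₀ Φ →
      ∀ (γ C : ℝ) (φ : ℕ → T3 → ℝ), 0 < γ → γ ≤ 1 / 15 → AdmissibleKernel γ C φ →
        ∀ t : ℝ, 0 < t → TailsOn σ a₀ θ₀ u₀ Φ t → SubBlockReynoldsOn σ a₀ θ₀ u₀ Φ γc φ t

/-- Registration anchor of this vocabulary file (`--supports stmt-AtomisticToContinuum-14868`): the bundled commutator
stub projects onto its first component G1. -/
theorem blockHB_vocab_anchor : DVCommutatorsStub → ∀ (a₀ θ₀ : T3 → ℝ) (u₀ : T3 → V3), NiceProfiles a₀ θ₀ u₀ →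
    ∀ σ : ℝ, 0 < σ → σ < 2⁻¹ → ∀ (γc C' : ℝ) (ψ : ℕ → T3 → ℝ), 1 / 6 < γc → γc < 1 / 3 → AdmissibleKernel γc C' ψ →
      ∀ (Φ : Flows σ) (t : ℝ), 0 < t → TailsOn σ a₀ θ₀ u₀ Φ t → FewCollisionsOn σ a₀ θ₀ u₀ Φ t →
        ∀ h δ : ℝ, 0 < h → h < 1 → 0 < δ → δ < 1 → IncrToMeasureOn σ a₀ θ₀ u₀ Φ ψ γc h δ t :=
  fun hC a₀ θ₀ u₀ hn σ hσ hσ2 γc C' ψ h1 h2 hadm Φ t ht hT hF h δ hh hh1 hδ hδ1 =>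
    (hC a₀ θ₀ u₀ hn σ hσ hσ2 γc C' ψ h1 h2 hadm Φ t ht hT hF h δ hh hh1 hδ hδ1).1

end

end Summit.AtomisticToContinuum.HydrodynamicLimit.Theorems.BlockHDissipation
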